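import Mathlib

/-!
# Crux `GrenetZeon.TwoDimCoefficients` (stmt-ValiantsHypothesis-8062) / rung `DualUnipotentThreeHalves`
# (stmt-ValiantsHypothesis-24318): the STAIRCASE LEMMA behind «(H) HessianRate on the layered family»

The plan of record for the 3/2 rung (✓ `threeHalves_of_hessianRate`, `…DualUnipotentHessianRate.lean`)
rests on CONJECTURE (H): a unipotent-dual / power-trace representation of width `m` and degree `d` has
`rank Hess_p ≤ C·m²/d` at every point `p`.  The evidence note `HESSIAN-RATE-LAYERED.md` (this seat,
attached to both items) PROVES (H) with `C = 2` on the whole single-window LAYERED family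
`f = tr(X₀X₁⋯X_{d−1}E)` (levels of arbitrary widths `w₀,…,w_d`, arbitrary point, arbitrary constant
corner `E`; the family of ✓ `…TraceChainProfile`, where (H) is tight at equal widths):
`rank Hess_p f ≤ Σ_i t·(w_i + w_{i+1}) ≤ 2·t·m`, `t = min_ℓ w_ℓ ≤ m/(d+1)`.  The proof: the Hessian is a
block matrix of Kronecker products `M_{ij} ⊗ O_{ij}` (path products LEAVING level `i+1` / ARRIVING at
level `i`); along the cyclic order of `j` the column spaces of the leaving products DECREASE and the row
spaces of the arriving products INCREASE, and the thinnest level lies on exactly one of the two sides,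
so one of the two spaces has dimension `≤ t`.  The dimension count that turns this into `t·(w_i + w_{i+1})`
per row block is the following pure linear-algebra statement, typed here as the kernel piece of the note:

* `finrank_span_vecMulVec_left_le` — matrices spanned by outer products `x yᵀ` with `x` in a subspace
  `R ≤ K^p` (and `y ∈ K^q` arbitrary) have dimension `≤ dim R · q`; `finrank_span_vecMulVec_right_le` —
  the mirror statement `≤ p · dim C`.
* ★ `finrank_iSup_span_vecMulVec_le_of_monotone_antitone` — **STAIRCASE LEMMA.**  If `R : Fin k → Sub(K^p)`
  is monotone, `C : Fin k → Sub(K^q)` antitone, and for every `s` one of `dim R_s ≤ t`, `dim C_s ≤ t`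
  holds, then `dim (Σ_s R_s ⊗ C_s) ≤ t·(p + q)`, where `R_s ⊗ C_s` is realised as the span of the outer
  products `x yᵀ`, `x ∈ R_s`, `y ∈ C_s`, inside `Matrix (Fin p) (Fin q) K`.  (The indices with
  `dim R_s ≤ t` form a down-set by monotonicity, so their `R_s` sit inside the LAST such `R_{s₀}`; on the
  complementary up-set `dim C_s ≤ t` and the `C_s` sit inside the FIRST such `C_{s₁}`.)

HONEST FRAMING: a def-free linear-algebra helper (any field); it is the counting step of a proof of (H)
on the layered family only — layered ⊂ triangularisable, where the 3/2 conclusion is already known by flats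
(✓ `sq_le_of_trace_pow_mul_strictUpper`), so NO stub, rung or crux is closed; the identification of the
Hessian blocks of `tr(X₀⋯X_{d−1}E)` with `M_{ij} ⊗ O_{ij}` is NOT typed here (note §6(i), ≈300 l over
✓ `…TraceChainHessian`).  `DualUnipotentBound`, 24318, (c) and `VP ≠ VNP` are NOT proved.
-/

-- single-conjunct layout `Summits/ValiantsHypothesis/ValiantsHypothesis`: the duplicated namespace
-- component is mandated by the tree.
set_option linter.dupNamespace false

noncomputable section

namespace Summit.ValiantsHypothesis.ValiantsHypothesis.Cruxes.TwoDimCoefficients.DimTwoCases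

open Matrix

variable {K : Type*} [Field K] {p q : ℕ}

/-- **Column-space bound.** The span of the outer products `x yᵀ`, `x ∈ R`, `y` arbitrary, has
dimension `≤ dim R · q` (it consists of matrices all of whose columns lie in `R`). [folklore] -/
theorem finrank_span_vecMulVec_left_le (R : Submodule K (Fin p → K)) :
    Module.finrank K (Submodule.span K
      {M : Matrix (Fin p) (Fin q) K | ∃ x ∈ R, ∃ y : Fin q → K, M = vecMulVec x y}) ≤
      Module.finrank K R * q := by
  -- the matrix whose columns are a given `q`-family of vectors of `R` (linear in the family)
  let Φ : (Fin q → R) →ₗ[K] Matrix (Fin p) (Fin q) K :=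
    { toFun := fun f => Matrix.of fun a b => ((f b : R) : Fin p → K) a
      map_add' := fun f g => by
        ext a b
        simp only [Matrix.of_apply, Pi.add_apply, Submodule.coe_add, Matrix.add_apply]
      map_smul' := fun c f => by
        ext a b
        simp only [Matrix.of_apply, Pi.smul_apply, Submodule.coe_smul, smul_eq_mul, RingHom.id_apply,
          Matrix.smul_apply] }
  have hle : Submodule.span K {M : Matrix (Fin p) (Fin q) K | ∃ x ∈ R, ∃ y : Fin q → K, M = vecMulVec x y}
      ≤ LinearMap.range Φ := by
    refine Submodule.span_le.mpr ?_
    rintro M ⟨x, hx, y, rfl⟩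
    refine ⟨fun b => y b • ⟨x, hx⟩, ?_⟩
    ext a b
    simp only [Φ, LinearMap.coe_mk, AddHom.coe_mk, Matrix.of_apply, Submodule.coe_smul,
      Pi.smul_apply, smul_eq_mul, vecMulVec_apply]
    ring
  calc Module.finrank K _ ≤ Module.finrank K (LinearMap.range Φ) := Submodule.finrank_mono hle
    _ ≤ Module.finrank K (Fin q → R) := LinearMap.finrank_range_le _
    _ = Module.finrank K R * q := by
        rw [Module.finrank_pi_fintype, Finset.sum_const, Finset.card_univ, Fintype.card_fin,
          smul_eq_mul, mul_comm]

/-- **Row-space bound.** The span of the outer products `x yᵀ`, `x` arbitrary, `y ∈ C`, has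
dimension `≤ p · dim C`. [folklore] -/
theorem finrank_span_vecMulVec_right_le (C : Submodule K (Fin q → K)) :
    Module.finrank K (Submodule.span K
      {M : Matrix (Fin p) (Fin q) K | ∃ x : Fin p → K, ∃ y ∈ C, M = vecMulVec x y}) ≤
      p * Module.finrank K C := by
  -- the matrix whose rows are a given `p`-family of vectors of `C` (linear in the family)
  let Ψ : (Fin p → C) →ₗ[K] Matrix (Fin p) (Fin q) K :=
    { toFun := fun g => Matrix.of fun a b => ((g a : C) : Fin q → K) b
      map_add' := fun f g => by
        ext a b
        simp only [Matrix.of_apply, Pi.add_apply, Submodule.coe_add, Matrix.add_apply]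
      map_smul' := fun c f => by
        ext a b
        simp only [Matrix.of_apply, Pi.smul_apply, Submodule.coe_smul, smul_eq_mul, RingHom.id_apply,
          Matrix.smul_apply] }
  have hle : Submodule.span K {M : Matrix (Fin p) (Fin q) K | ∃ x : Fin p → K, ∃ y ∈ C, M = vecMulVec x y}
      ≤ LinearMap.range Ψ := by
    refine Submodule.span_le.mpr ?_
    rintro M ⟨x, y, hy, rfl⟩
    refine ⟨fun a => x a • ⟨y, hy⟩, ?_⟩
    ext a b
    simp only [Ψ, LinearMap.coe_mk, AddHom.coe_mk, Matrix.of_apply, Submodule.coe_smul,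
      Pi.smul_apply, smul_eq_mul, vecMulVec_apply]
  calc Module.finrank K _ ≤ Module.finrank K (LinearMap.range Ψ) := Submodule.finrank_mono hle
    _ ≤ Module.finrank K (Fin p → C) := LinearMap.finrank_range_le _
    _ = p * Module.finrank K C := by
        rw [Module.finrank_pi_fintype, Finset.sum_const, Finset.card_univ, Fintype.card_fin,
          smul_eq_mul]

/-- **STAIRCASE LEMMA** (the counting step of «(H) on the layered family», note §3).  For a monotone
chain `R` of subspaces of `K^p` and an antitone chain `C` of subspaces of `K^q` such that at every index
one of the two has dimension `≤ t`, the span of all outer products `x yᵀ` with `x ∈ R_s`, `y ∈ C_s`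
(over all `s`) has dimension `≤ t·(p + q)`. [folklore] -/
theorem finrank_iSup_span_vecMulVec_le_of_monotone_antitone {k t : ℕ}
    (R : Fin k → Submodule K (Fin p → K)) (C : Fin k → Submodule K (Fin q → K))
    (hR : Monotone R) (hC : Antitone C)
    (ht : ∀ s, Module.finrank K (R s) ≤ t ∨ Module.finrank K (C s) ≤ t) :
    Module.finrank K (⨆ s, Submodule.span K
      {M : Matrix (Fin p) (Fin q) K | ∃ x ∈ R s, ∃ y ∈ C s, M = vecMulVec x y} :
        Submodule K (Matrix (Fin p) (Fin q) K)) ≤ t * (p + q) := by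
  classical
  -- the down-set of indices where `R` is small, and its last element
  set D : Finset (Fin k) := Finset.univ.filter fun s => Module.finrank K (R s) ≤ t with hD
  set U : Finset (Fin k) := Finset.univ.filter fun s => ¬ Module.finrank K (R s) ≤ t with hU
  let Rstar : Submodule K (Fin p → K) := ⨆ s ∈ D, R s
  let Cstar : Submodule K (Fin q → K) := ⨆ s ∈ U, C s
  have hRstar : Module.finrank K Rstar ≤ t := by
    by_cases h : D.Nonempty
    · have hmem := Finset.max'_mem D h
      simp only [hD, Finset.mem_filter, Finset.mem_univ, true_and] at hmem
      refine le_trans (Submodule.finrank_mono ?_) hmem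
      exact iSup₂_le fun s hs => hR (Finset.le_max' D s (by rw [hD]; exact hs))
    · have hbot : Rstar ≤ ⊥ := iSup₂_le fun s hs => absurd ⟨s, hs⟩ h
      have h0 := Submodule.finrank_mono hbot
      rw [finrank_bot] at h0
      exact h0.trans (Nat.zero_le _)
  have hCstar : Module.finrank K Cstar ≤ t := by
    by_cases h : U.Nonempty
    · have hmem := Finset.min'_mem U h
      simp only [hU, Finset.mem_filter, Finset.mem_univ, true_and] at hmem
      have hC' : Module.finrank K (C (U.min' h)) ≤ t := (ht (U.min' h)).resolve_left (by
        convert hmem using 3)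
      refine le_trans (Submodule.finrank_mono ?_) hC'
      exact iSup₂_le fun s hs => hC (Finset.min'_le U s (by rw [hU]; exact hs))
    · have hbot : Cstar ≤ ⊥ := iSup₂_le fun s hs => absurd ⟨s, hs⟩ h
      have h0 := Submodule.finrank_mono hbot
      rw [finrank_bot] at h0
      exact h0.trans (Nat.zero_le _)
  have hRle : ∀ s, Module.finrank K (R s) ≤ t → R s ≤ Rstar := by
    intro s hs
    have hsD : s ∈ D := by
      simp only [hD, Finset.mem_filter, Finset.mem_univ, true_and]; exact hs
    exact le_iSup₂ (f := fun s' (_ : s' ∈ D) => R s') s hsD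
  have hCle : ∀ s, ¬ Module.finrank K (R s) ≤ t → C s ≤ Cstar := by
    intro s hs
    have hsU : s ∈ U := by
      simp only [hU, Finset.mem_filter, Finset.mem_univ, true_and]; exact hs
    exact le_iSup₂ (f := fun s' (_ : s' ∈ U) => C s') s hsU
  -- the two receiving spaces
  set SL := Submodule.span K
    {M : Matrix (Fin p) (Fin q) K | ∃ x ∈ Rstar, ∃ y : Fin q → K, M = vecMulVec x y} with hSL
  set SR := Submodule.span K
    {M : Matrix (Fin p) (Fin q) K | ∃ x : Fin p → K, ∃ y ∈ Cstar, M = vecMulVec x y} with hSR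
  have hsup : (⨆ s, Submodule.span K
      {M : Matrix (Fin p) (Fin q) K | ∃ x ∈ R s, ∃ y ∈ C s, M = vecMulVec x y} :
        Submodule K (Matrix (Fin p) (Fin q) K)) ≤ SL ⊔ SR := by
    refine iSup_le fun s => ?_
    by_cases hs : Module.finrank K (R s) ≤ t
    · refine le_sup_left.trans' (Submodule.span_mono ?_)
      rintro M ⟨x, hx, y, -, rfl⟩
      exact ⟨x, hRle s hs hx, y, rfl⟩
    · refine le_sup_right.trans' (Submodule.span_mono ?_)
      rintro M ⟨x, -, y, hy, rfl⟩
      exact ⟨x, y, hCle s hs hy, rfl⟩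
  have hsum : Module.finrank K ↥(SL ⊔ SR) ≤ Module.finrank K SL + Module.finrank K SR := by
    have := Submodule.finrank_sup_add_finrank_inf_eq SL SR
    omega
  calc Module.finrank K _ ≤ Module.finrank K ↥(SL ⊔ SR) := Submodule.finrank_mono hsup
    _ ≤ Module.finrank K SL + Module.finrank K SR := hsum
    _ ≤ Module.finrank K Rstar * q + p * Module.finrank K Cstar :=
        Nat.add_le_add (finrank_span_vecMulVec_left_le Rstar) (finrank_span_vecMulVec_right_le Cstar)
    _ ≤ t * q + p * t := Nat.add_le_add (Nat.mul_le_mul_right _ hRstar) (Nat.mul_le_mul_left _ hCstar)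
    _ = t * (p + q) := by ring

/-! ### §2 (appended) The ROW-BLOCK BOUND: sandwiches `Oᵀ·X·Mᵀ` through nested row/column spaces

Dictionary to the note `HESSIAN-RATE-LAYERED.md` §2–3: fix an edge level `i` of the chain
`tr(X₀⋯X_{d−1}E)`, put `w = w_i`, `w' = w_{i+1}`; for every other edge level `j` let `O j` be the
ARRIVING product (its rows indexed by the level just after edge `j`, its columns by level `i`) and
`M j` the LEAVING product (rows = level `i+1`, columns = the tail level of edge `j`).  The `(i,j)` block
of the Hessian sends a perturbation `X` of edge level `j` to `(O j)ᵀ·X·(M j)ᵀ` (entry `(a,b)` =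
`Σ_{e,c} O_{ea} X_{ec} M_{bc}`), so the column space of the whole row block `i` is the span below, and with
`R j ∋` every row of `O j` (monotone along the cyclic order), `C j ∋` every column of `M j` (antitone),
one of the two of dimension `≤ t` (the thinnest level lies on exactly one of the two paths), the row
block has rank `≤ t·(w_i + w_{i+1})`.  Summing over `i`: `rank Hess ≤ 2·t·m ≤ 2m²/(d+1)` — (H) with
`C = 2` on the layered family.  (The identification of the Hessian blocks themselves is note §6(i),
not typed here.) -/

/-- A sandwich `Oᵀ·X·Mᵀ` is the `X`-weighted sum of the outer products (row `e` of `O`) ⊗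
(column `c` of `M`). [folklore] -/
theorem transpose_mul_mul_transpose_eq_sum_vecMulVec {w w' : ℕ} {κ ι : Type*} [Fintype κ] [Fintype ι]
    (O : Matrix κ (Fin w) K) (M : Matrix (Fin w') ι K) (X : Matrix κ ι K) :
    Oᵀ * X * Mᵀ = ∑ e, ∑ c, X e c • vecMulVec (fun a => O e a) (fun b => M b c) := by
  ext a b
  simp only [Matrix.mul_apply, Matrix.transpose_apply, Matrix.sum_apply, Matrix.smul_apply,
    vecMulVec_apply, smul_eq_mul]
  conv_rhs => rw [Finset.sum_comm]
  refine Finset.sum_congr rfl fun c _ => ?_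
  rw [Finset.sum_mul]
  exact Finset.sum_congr rfl fun e _ => by ring

/-- **ROW-BLOCK BOUND** (note §3: rank of the `i`-th row block of the Hessian of the chain).  Let
`O j : κ_j × w`, `M j : w' × ι_j` (`j < k`) be matrices, `R` a MONOTONE chain of subspaces of `K^w`
containing every row of the corresponding `O j`, `C` an ANTITONE chain of subspaces of `K^{w'}`
containing every column of `M j`, and suppose that at every `j` one of `dim R_j ≤ t`, `dim C_j ≤ t`
holds.  Then all the sandwiches `(O j)ᵀ·X·(M j)ᵀ` (`j < k`, `X` arbitrary) together span a space of
dimension `≤ t·(w + w')`. [folklore] -/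
theorem finrank_span_sandwich_le_of_monotone_antitone {k t w w' : ℕ} {κ ι : Fin k → Type*}
    [∀ j, Fintype (κ j)] [∀ j, Fintype (ι j)]
    (O : (j : Fin k) → Matrix (κ j) (Fin w) K) (M : (j : Fin k) → Matrix (Fin w') (ι j) K)
    (R : Fin k → Submodule K (Fin w → K)) (C : Fin k → Submodule K (Fin w' → K))
    (hR : Monotone R) (hC : Antitone C)
    (hO : ∀ j e, (fun a => O j e a) ∈ R j) (hM : ∀ j c, (fun b => M j b c) ∈ C j)
    (ht : ∀ j, Module.finrank K (R j) ≤ t ∨ Module.finrank K (C j) ≤ t) :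
    Module.finrank K (Submodule.span K {Y : Matrix (Fin w) (Fin w') K |
      ∃ j, ∃ X : Matrix (κ j) (ι j) K, Y = (O j)ᵀ * X * (M j)ᵀ}) ≤ t * (w + w') := by
  have hle : Submodule.span K {Y : Matrix (Fin w) (Fin w') K |
        ∃ j, ∃ X : Matrix (κ j) (ι j) K, Y = (O j)ᵀ * X * (M j)ᵀ} ≤
      (⨆ s, Submodule.span K
        {N : Matrix (Fin w) (Fin w') K | ∃ x ∈ R s, ∃ y ∈ C s, N = vecMulVec x y} :
          Submodule K (Matrix (Fin w) (Fin w') K)) := by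
    refine Submodule.span_le.mpr ?_
    rintro Y ⟨j, X, rfl⟩
    rw [transpose_mul_mul_transpose_eq_sum_vecMulVec]
    refine Submodule.sum_mem _ fun e _ => Submodule.sum_mem _ fun c _ => Submodule.smul_mem _ _ ?_
    exact Submodule.mem_iSup_of_mem j (Submodule.subset_span ⟨_, hO j e, _, hM j c, rfl⟩)
  exact (Submodule.finrank_mono hle).trans
    (finrank_iSup_span_vecMulVec_le_of_monotone_antitone R C hR hC ht)

/-! ### §3 (appended) RELATIVE form: dimensions measured inside fixed receiving subspaces `X ≤ K^p`, `Y ≤ K^q`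

In the port of note §3 everything lives in the AMBIENT `M_m(K)`: the `i`-th Hessian row block is spanned by
`D_{i+1}·P·U'·Q·D_i`-type sandwiches (`D_ℓ` the level projectors), i.e. by outer products `x yᵀ` with `x` in the
level-`(i+1)` coordinate space `X` (dim `w_{i+1}`) and `y` in the level-`i` space `Y` (dim `w_i`).  The bound one
needs is therefore `t·(dim X + dim Y) = t·(w_{i+1} + w_i)`, not `t·(p + q) = 2tm`; this section proves that
relative form (the absolute §1–§2 statements are the case `X = Y = ⊤`). -/

/-- `dim span{x yᵀ : x ∈ R, y ∈ C} ≤ dim R · dim C` (the span is the image of `R ⊗ C`). [folklore] -/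
theorem finrank_span_vecMulVec_le (R : Submodule K (Fin p → K)) (C : Submodule K (Fin q → K)) :
    Module.finrank K (Submodule.span K
      {M : Matrix (Fin p) (Fin q) K | ∃ x ∈ R, ∃ y ∈ C, M = vecMulVec x y}) ≤
      Module.finrank K R * Module.finrank K C := by
  let B : R →ₗ[K] C →ₗ[K] Matrix (Fin p) (Fin q) K :=
    LinearMap.mk₂ K (fun x y => vecMulVec (x : Fin p → K) (y : Fin q → K))
      (fun x x' y => by simp only [Submodule.coe_add, add_vecMulVec])
      (fun c x y => by simp only [Submodule.coe_smul, smul_vecMulVec])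
      (fun x y y' => by simp only [Submodule.coe_add, vecMulVec_add])
      (fun c x y => by simp only [Submodule.coe_smul, vecMulVec_smul])
  have hle : Submodule.span K {M : Matrix (Fin p) (Fin q) K | ∃ x ∈ R, ∃ y ∈ C, M = vecMulVec x y} ≤
      LinearMap.range (TensorProduct.lift B) := by
    refine Submodule.span_le.mpr ?_
    rintro M ⟨x, hx, y, hy, rfl⟩
    exact ⟨⟨x, hx⟩ ⊗ₜ ⟨y, hy⟩, by simp only [TensorProduct.lift.tmul, B, LinearMap.mk₂_apply]⟩
  calc Module.finrank K _ ≤ Module.finrank K (LinearMap.range (TensorProduct.lift B)) :=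
        Submodule.finrank_mono hle
    _ ≤ Module.finrank K (TensorProduct K R C) := LinearMap.finrank_range_le _
    _ = Module.finrank K R * Module.finrank K C := Module.finrank_tensorProduct

/-- **STAIRCASE LEMMA, relative form.**  As `finrank_iSup_span_vecMulVec_le_of_monotone_antitone`, but with
all `R_s` inside a fixed `X ≤ K^p` and all `C_s` inside a fixed `Y ≤ K^q`: the bound is
`t·(dim X + dim Y)`. [folklore] -/
theorem finrank_iSup_span_vecMulVec_le_of_monotone_antitone_of_le {k t : ℕ}
    (R : Fin k → Submodule K (Fin p → K)) (C : Fin k → Submodule K (Fin q → K))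
    (X : Submodule K (Fin p → K)) (Y : Submodule K (Fin q → K))
    (hRX : ∀ s, R s ≤ X) (hCY : ∀ s, C s ≤ Y) (hR : Monotone R) (hC : Antitone C)
    (ht : ∀ s, Module.finrank K (R s) ≤ t ∨ Module.finrank K (C s) ≤ t) :
    Module.finrank K (⨆ s, Submodule.span K
      {M : Matrix (Fin p) (Fin q) K | ∃ x ∈ R s, ∃ y ∈ C s, M = vecMulVec x y} :
        Submodule K (Matrix (Fin p) (Fin q) K)) ≤
      t * (Module.finrank K X + Module.finrank K Y) := by
  classical
  set D : Finset (Fin k) := Finset.univ.filter fun s => Module.finrank K (R s) ≤ t with hD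
  set U : Finset (Fin k) := Finset.univ.filter fun s => ¬ Module.finrank K (R s) ≤ t with hU
  let Rstar : Submodule K (Fin p → K) := ⨆ s ∈ D, R s
  let Cstar : Submodule K (Fin q → K) := ⨆ s ∈ U, C s
  have hRstar : Module.finrank K Rstar ≤ t := by
    by_cases h : D.Nonempty
    · have hmem := Finset.max'_mem D h
      simp only [hD, Finset.mem_filter, Finset.mem_univ, true_and] at hmem
      refine le_trans (Submodule.finrank_mono ?_) hmem
      exact iSup₂_le fun s hs => hR (Finset.le_max' D s (by rw [hD]; exact hs))
    · have hbot : Rstar ≤ ⊥ := iSup₂_le fun s hs => absurd ⟨s, hs⟩ h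
      have h0 := Submodule.finrank_mono hbot
      rw [finrank_bot] at h0
      exact h0.trans (Nat.zero_le _)
  have hCstar : Module.finrank K Cstar ≤ t := by
    by_cases h : U.Nonempty
    · have hmem := Finset.min'_mem U h
      simp only [hU, Finset.mem_filter, Finset.mem_univ, true_and] at hmem
      have hC' : Module.finrank K (C (U.min' h)) ≤ t := (ht (U.min' h)).resolve_left (by
        convert hmem using 3)
      refine le_trans (Submodule.finrank_mono ?_) hC'
      exact iSup₂_le fun s hs => hC (Finset.min'_le U s (by rw [hU]; exact hs))
    · have hbot : Cstar ≤ ⊥ := iSup₂_le fun s hs => absurd ⟨s, hs⟩ h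
      have h0 := Submodule.finrank_mono hbot
      rw [finrank_bot] at h0
      exact h0.trans (Nat.zero_le _)
  have hRle : ∀ s, Module.finrank K (R s) ≤ t → R s ≤ Rstar := by
    intro s hs
    have hsD : s ∈ D := by
      simp only [hD, Finset.mem_filter, Finset.mem_univ, true_and]; exact hs
    exact le_iSup₂ (f := fun s' (_ : s' ∈ D) => R s') s hsD
  have hCle : ∀ s, ¬ Module.finrank K (R s) ≤ t → C s ≤ Cstar := by
    intro s hs
    have hsU : s ∈ U := by
      simp only [hU, Finset.mem_filter, Finset.mem_univ, true_and]; exact hs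
    exact le_iSup₂ (f := fun s' (_ : s' ∈ U) => C s') s hsU
  set SL := Submodule.span K
    {M : Matrix (Fin p) (Fin q) K | ∃ x ∈ Rstar, ∃ y ∈ Y, M = vecMulVec x y} with hSL
  set SR := Submodule.span K
    {M : Matrix (Fin p) (Fin q) K | ∃ x ∈ X, ∃ y ∈ Cstar, M = vecMulVec x y} with hSR
  have hsup : (⨆ s, Submodule.span K
      {M : Matrix (Fin p) (Fin q) K | ∃ x ∈ R s, ∃ y ∈ C s, M = vecMulVec x y} :
        Submodule K (Matrix (Fin p) (Fin q) K)) ≤ SL ⊔ SR := by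
    refine iSup_le fun s => ?_
    by_cases hs : Module.finrank K (R s) ≤ t
    · refine le_sup_left.trans' (Submodule.span_mono ?_)
      rintro M ⟨x, hx, y, hy, rfl⟩
      exact ⟨x, hRle s hs hx, y, hCY s hy, rfl⟩
    · refine le_sup_right.trans' (Submodule.span_mono ?_)
      rintro M ⟨x, hx, y, hy, rfl⟩
      exact ⟨x, hRX s hx, y, hCle s hs hy, rfl⟩
  have hsum : Module.finrank K ↥(SL ⊔ SR) ≤ Module.finrank K SL + Module.finrank K SR := by
    have := Submodule.finrank_sup_add_finrank_inf_eq SL SR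
    omega
  calc Module.finrank K _ ≤ Module.finrank K ↥(SL ⊔ SR) := Submodule.finrank_mono hsup
    _ ≤ Module.finrank K SL + Module.finrank K SR := hsum
    _ ≤ Module.finrank K Rstar * Module.finrank K Y + Module.finrank K X * Module.finrank K Cstar :=
        Nat.add_le_add (finrank_span_vecMulVec_le Rstar Y) (finrank_span_vecMulVec_le X Cstar)
    _ ≤ t * Module.finrank K Y + Module.finrank K X * t :=
        Nat.add_le_add (Nat.mul_le_mul_right _ hRstar) (Nat.mul_le_mul_left _ hCstar)
    _ = t * (Module.finrank K X + Module.finrank K Y) := by ring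

/-- **ROW-BLOCK BOUND, relative form** (the shape used in the ambient `M_m` port: `X` = coordinates of
level `i`... on the row side, `Y` on the column side): all sandwiches `(O j)ᵀ·X'·(M j)ᵀ` together span
`≤ t·(dim X + dim Y)` dimensions when the rows of every `O j` lie in the monotone chain `R ≤ X` and the
columns of every `M j` in the antitone chain `C ≤ Y`, one of the two of dimension `≤ t` at each `j`.
[folklore] -/
theorem finrank_span_sandwich_le_of_monotone_antitone_of_le {k t w w' : ℕ} {κ ι : Fin k → Type*}
    [∀ j, Fintype (κ j)] [∀ j, Fintype (ι j)]
    (O : (j : Fin k) → Matrix (κ j) (Fin w) K) (M : (j : Fin k) → Matrix (Fin w') (ι j) K)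
    (R : Fin k → Submodule K (Fin w → K)) (C : Fin k → Submodule K (Fin w' → K))
    (X : Submodule K (Fin w → K)) (Y : Submodule K (Fin w' → K))
    (hRX : ∀ s, R s ≤ X) (hCY : ∀ s, C s ≤ Y) (hR : Monotone R) (hC : Antitone C)
    (hO : ∀ j e, (fun a => O j e a) ∈ R j) (hM : ∀ j c, (fun b => M j b c) ∈ C j)
    (ht : ∀ j, Module.finrank K (R j) ≤ t ∨ Module.finrank K (C j) ≤ t) :
    Module.finrank K (Submodule.span K {Z : Matrix (Fin w) (Fin w') K |
      ∃ j, ∃ X' : Matrix (κ j) (ι j) K, Z = (O j)ᵀ * X' * (M j)ᵀ}) ≤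
      t * (Module.finrank K X + Module.finrank K Y) := by
  have hle : Submodule.span K {Z : Matrix (Fin w) (Fin w') K |
        ∃ j, ∃ X' : Matrix (κ j) (ι j) K, Z = (O j)ᵀ * X' * (M j)ᵀ} ≤
      (⨆ s, Submodule.span K
        {N : Matrix (Fin w) (Fin w') K | ∃ x ∈ R s, ∃ y ∈ C s, N = vecMulVec x y} :
          Submodule K (Matrix (Fin w) (Fin w') K)) := by
    refine Submodule.span_le.mpr ?_
    rintro Z ⟨j, X', rfl⟩
    rw [transpose_mul_mul_transpose_eq_sum_vecMulVec]
    refine Submodule.sum_mem _ fun e _ => Submodule.sum_mem _ fun c _ => Submodule.smul_mem _ _ ?_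
    exact Submodule.mem_iSup_of_mem j (Submodule.subset_span ⟨_, hO j e, _, hM j c, rfl⟩)
  exact (Submodule.finrank_mono hle).trans
    (finrank_iSup_span_vecMulVec_le_of_monotone_antitone_of_le R C X Y hRX hCY hR hC ht)

end Summit.ValiantsHypothesis.ValiantsHypothesis.Cruxes.TwoDimCoefficients.DimTwoCases

end
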